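import Literature.AlgebraicTopology.KTheory.PencilProjection
import Mathlib.LinearAlgebra.Matrix.SchurComplement
import HarnessLib

/-!
# Spectral projections of pencils: block sums, units, and the special pencils of the index computation

Complements to `PencilProjection.lean` (Husemöller, *Fibre Bundles*, Ch. 11 §4), used for the
index map of Bott periodicity (op. cit. §5):

* `IsRegular.P0_apply` — entries of `P₀` as scalar circle integrals; `res_eq_of_pencil_mul_eq`;
* invariances: `IsRegular.P0_unit_mul : P₀(c a, c b) = P₀(a, b)` for units `c` (left
  multiplication by a unit from the base), `IsRegular.P0_conj : P₀(c a d, c b d) = c P₀ d`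
  (`c d = d c = 1`), `IsRegular.P0_reindex`;
* block sums: `IsRegular.P0_fromBlocks : P₀(a₁ ⊕ a₂, b₁ ⊕ b₂) = P₀(a₁,b₁) ⊕ P₀(a₂,b₂)`;
* special pencils: `P0_zero_left : P₀(0, b) = 0`, `P0_of_b_eq_zero : P₀(a, 0) = 1` (`a` a unit),
  and for an idempotent `e` the linearisation `w spB + spA e` of `z e + (1 - e)`
  (`spA e = [[1-e, e],[0,1]]`, `spB = [[0,0],[-1,0]]`): explicit inverse `spInv`, regularity,
  `res_sp = [[w⁻¹ e, 0],[-(1-e), 0]]` and **`P0_sp : P₀ = e ⊕ 0`**.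

Everything is proved; no named facts.

## References

* D. Husemöller, *Fibre Bundles*, 3rd ed. (1994) [HusemollerFibreBundles1994]: Ch. 11 §4 (4.2),
  Props. 4.5–4.6, §5 Thm. 5.4.
-/

noncomputable section

open Complex MeasureTheory Metric Set Filter intervalIntegral
open scoped Real Topology Matrix

namespace Literature.AlgebraicTopology.KTheory.Pencil

attribute [local instance] Matrix.linftyOpNormedRing Matrix.linftyOpNormedAlgebra

variable {ι : Type} [Fintype ι] [DecidableEq ι]

/-! ### Entries of `P₀`; identification of `res` from an equation -/

/-- Entry evaluation as a continuous linear map. [folklore] -/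
def entryCLM (i j : ι) : Matrix ι ι ℂ →L[ℂ] ℂ :=
  LinearMap.toContinuousLinearMap { toFun := fun M ↦ M i j, map_add' := fun _ _ ↦ rfl, map_smul' := fun _ _ ↦ rfl }

omit [DecidableEq ι] in
/-- Unfolding lemma. [folklore] -/
@[simp] theorem entryCLM_apply (i j : ι) (M : Matrix ι ι ℂ) : entryCLM i j M = M i j := rfl

/-- The entries of `P₀` are the circle integrals of the entries of the integrand. [cite: HusemollerFibreBundles1994, Ch. 11 Notation 4.2] -/
theorem IsRegular.P0_apply {a b : Matrix ι ι ℂ} (h : IsRegular a b) (i j : ι) :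
    P0 a b i j = (2 * π * I)⁻¹ * ∮ w in C(0, 1), res a b w i j := by
  have key := clm_circleIntegral (entryCLM i j) h.circleIntegrable_res
  calc P0 a b i j = entryCLM i j (P0 a b) := rfl
    _ = (2 * π * I)⁻¹ * entryCLM i j (∮ w in C(0, 1), res a b w) := by rw [P0, map_smul, smul_eq_mul]
    _ = (2 * π * I)⁻¹ * ∮ w in C(0, 1), res a b w i j := congrArg ((2 * π * I : ℂ)⁻¹ * ·) key.symm

/-- If `(w a + b) R = a` then `R = (w a + b)⁻¹ a`. [folklore] -/
theorem res_eq_of_pencil_mul_eq {a b : Matrix ι ι ℂ} {w : ℂ} (hw : IsUnit (pencil a b w)) {R : Matrix ι ι ℂ}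
    (hR : pencil a b w * R = a) : res a b w = R := by
  obtain ⟨W, hW⟩ := hw
  rw [res, ← hW, Ring.inverse_unit, ← hR, ← hW, ← Matrix.mul_assoc, Units.inv_mul, Matrix.one_mul]

/-! ### Left multiplication by a unit; conjugation -/

omit [DecidableEq ι] in
/-- Auxiliary statement for spectral projections of special pencils. [folklore] -/
theorem pencil_unit_mul (a b c : Matrix ι ι ℂ) (w : ℂ) : pencil (c * a) (c * b) w = c * pencil a b w := by
  rw [pencil, pencil, Matrix.mul_add, Matrix.mul_smul]

/-- `res (c a) (c b) = res a b` for a unit `c`. [cite: HusemollerFibreBundles1994, Ch. 11 Notation 4.2] -/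
theorem res_unit_mul {a b : Matrix ι ι ℂ} {c : Matrix ι ι ℂ} (hc : IsUnit c) {w : ℂ} (hw : IsUnit (pencil a b w)) :
    res (c * a) (c * b) w = res a b w := by
  have hw' : IsUnit (pencil (c * a) (c * b) w) := by rw [pencil_unit_mul]; exact hc.mul hw
  refine res_eq_of_pencil_mul_eq hw' ?_
  obtain ⟨W, hW⟩ := hw
  rw [pencil_unit_mul, res, ← hW, Ring.inverse_unit, Matrix.mul_assoc, ← Matrix.mul_assoc (W : Matrix ι ι ℂ), Units.mul_inv,
    Matrix.one_mul]

/-- Auxiliary statement for spectral projections of special pencils. [folklore] -/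
theorem IsRegular.unit_mul {a b : Matrix ι ι ℂ} (h : IsRegular a b) {c : Matrix ι ι ℂ} (hc : IsUnit c) : IsRegular (c * a) (c * b) := by
  intro w hw
  rw [pencil_unit_mul]; exact hc.mul (h w hw)

/-- **`P₀(c a, c b) = P₀(a, b)`** for a unit `c`: left multiplication by units does not change the
spectral projection. [cite: HusemollerFibreBundles1994, Ch. 11 Notation 4.2] -/
theorem IsRegular.P0_unit_mul {a b : Matrix ι ι ℂ} (h : IsRegular a b) {c : Matrix ι ι ℂ} (hc : IsUnit c) :
    P0 (c * a) (c * b) = P0 a b := by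
  rw [P0, P0]
  congr 1
  refine circleIntegral.integral_congr zero_le_one fun w hw ↦ ?_
  exact res_unit_mul hc (h w (by simpa using hw))

omit [DecidableEq ι] in
/-- Auxiliary statement for spectral projections of special pencils. [folklore] -/
theorem pencil_conj (a b c d : Matrix ι ι ℂ) (w : ℂ) : pencil (c * a * d) (c * b * d) w = c * pencil a b w * d := by
  rw [pencil, pencil, Matrix.mul_add, Matrix.add_mul, Matrix.mul_smul, Matrix.smul_mul]

/-- `res (c a c⁻¹) (c b c⁻¹) = c (res a b) c⁻¹`. [cite: HusemollerFibreBundles1994, Ch. 11 Notation 4.2] -/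
theorem res_conj {a b c d : Matrix ι ι ℂ} (hcd : c * d = 1) (hdc : d * c = 1) {w : ℂ} (hw : IsUnit (pencil a b w)) :
    res (c * a * d) (c * b * d) w = c * res a b w * d := by
  have hc : IsUnit c := ⟨⟨c, d, hcd, hdc⟩, rfl⟩
  have hd : IsUnit d := ⟨⟨d, c, hdc, hcd⟩, rfl⟩
  have hw' : IsUnit (pencil (c * a * d) (c * b * d) w) := by rw [pencil_conj]; exact (hc.mul hw).mul hd
  refine res_eq_of_pencil_mul_eq hw' ?_
  obtain ⟨W, hW⟩ := hw
  rw [pencil_conj, res, ← hW, Ring.inverse_unit]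
  calc c * ↑W * d * (c * (↑W⁻¹ * a) * d) = c * (↑W * (d * c) * ↑W⁻¹) * a * d := by simp only [Matrix.mul_assoc]
    _ = c * a * d := by rw [hdc, Matrix.mul_one, Units.mul_inv, Matrix.mul_one]

/-- Auxiliary statement for spectral projections of special pencils. [folklore] -/
theorem IsRegular.conj {a b c d : Matrix ι ι ℂ} (h : IsRegular a b) (hcd : c * d = 1) (hdc : d * c = 1) :
    IsRegular (c * a * d) (c * b * d) := by
  intro w hw
  have hc : IsUnit c := ⟨⟨c, d, hcd, hdc⟩, rfl⟩
  have hd : IsUnit d := ⟨⟨d, c, hdc, hcd⟩, rfl⟩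
  rw [pencil_conj]; exact (hc.mul (h w hw)).mul hd

/-- **`P₀` is conjugation-equivariant**: `P₀(c a d, c b d) = c P₀(a,b) d` for `c d = d c = 1`. [cite: HusemollerFibreBundles1994, Ch. 11 Notation 4.2] -/
theorem IsRegular.P0_conj {a b c d : Matrix ι ι ℂ} (h : IsRegular a b) (hcd : c * d = 1) (hdc : d * c = 1) :
    P0 (c * a * d) (c * b * d) = c * P0 a b * d := by
  have hi : CircleIntegrable (fun w ↦ c * res a b w) 0 1 :=
    ContinuousOn.circleIntegrable zero_le_one fun w hw ↦
      (continuousAt_const.mul (continuousAt_res a b (h w (by simpa using hw)))).continuousWithinAt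
  rw [P0, P0, Matrix.mul_smul, Matrix.smul_mul, ← circleIntegral_const_mul _ h.circleIntegrable_res,
    ← circleIntegral_mul_const _ hi]
  congr 1
  refine circleIntegral.integral_congr zero_le_one fun w hw ↦ ?_
  rw [res_conj hcd hdc (h w (by simpa using hw)), Matrix.mul_assoc]

/-! ### `∮` of constants and of `w⁻¹` over the unit circle -/

omit [Fintype ι] [DecidableEq ι] in
/-- Auxiliary statement for spectral projections of special pencils. [folklore] -/
theorem circleIntegral_const_eq_zero {E : Type*} [NormedAddCommGroup E] [NormedSpace ℂ E] (c : E) : (∮ _w in C(0, 1), c) = 0 :=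
  circleIntegral_eq_zero_of_differentiable_on_off_countable zero_le_one countable_empty continuousOn_const
    fun _ _ ↦ differentiableAt_const c

omit [Fintype ι] [DecidableEq ι] in
/-- Auxiliary statement for spectral projections of special pencils. [folklore] -/
theorem circleIntegral_inv_unit : (∮ w in C(0, 1), w⁻¹) = 2 * π * I := by
  have := circleIntegral.integral_sub_inv_of_mem_ball (c := (0 : ℂ)) (w := 0) (R := 1) (by simp)
  simpa using this

/-- `(w a + b) · res = a`. [folklore] -/
theorem pencil_mul_res_self {a b : Matrix ι ι ℂ} {w : ℂ} (hw : IsUnit (pencil a b w)) : pencil a b w * res a b w = a := by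
  obtain ⟨W, hW⟩ := hw
  rw [res, ← hW, Ring.inverse_unit, ← Matrix.mul_assoc, Units.mul_inv, Matrix.one_mul]

/-! ### Block-diagonal pencils -/

section Blocks

variable {ι₁ ι₂ : Type} [Fintype ι₁] [DecidableEq ι₁] [Fintype ι₂] [DecidableEq ι₂]

omit [Fintype ι₁] [DecidableEq ι₁] [Fintype ι₂] [DecidableEq ι₂] in
/-- Auxiliary statement for spectral projections of special pencils. [folklore] -/
theorem pencil_fromBlocks (a₁ b₁ : Matrix ι₁ ι₁ ℂ) (a₂ b₂ : Matrix ι₂ ι₂ ℂ) (w : ℂ) :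
    pencil (Matrix.fromBlocks a₁ 0 0 a₂) (Matrix.fromBlocks b₁ 0 0 b₂) w =
      Matrix.fromBlocks (pencil a₁ b₁ w) 0 0 (pencil a₂ b₂ w) := by
  simp only [pencil, Matrix.fromBlocks_smul, Matrix.fromBlocks_add, smul_zero, add_zero]

/-- Auxiliary statement for spectral projections of special pencils. [folklore] -/
theorem isUnit_fromBlocks_diag {A : Matrix ι₁ ι₁ ℂ} {D : Matrix ι₂ ι₂ ℂ} (hA : IsUnit A) (hD : IsUnit D) :
    IsUnit (Matrix.fromBlocks A 0 0 D) :=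
  Matrix.isUnit_fromBlocks_zero₂₁.2 ⟨hA, hD⟩

/-- Block sums of regular pencils are regular. [folklore] -/
theorem IsRegular.fromBlocks {a₁ b₁ : Matrix ι₁ ι₁ ℂ} {a₂ b₂ : Matrix ι₂ ι₂ ℂ} (h₁ : IsRegular a₁ b₁) (h₂ : IsRegular a₂ b₂) :
    IsRegular (Matrix.fromBlocks a₁ 0 0 a₂) (Matrix.fromBlocks b₁ 0 0 b₂) := fun w hw ↦ by
  rw [pencil_fromBlocks]; exact isUnit_fromBlocks_diag (h₁ w hw) (h₂ w hw)

/-- `res` of a block sum is the block sum of the `res`. [folklore] -/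
theorem res_fromBlocks {a₁ b₁ : Matrix ι₁ ι₁ ℂ} {a₂ b₂ : Matrix ι₂ ι₂ ℂ} {w : ℂ} (hw₁ : IsUnit (pencil a₁ b₁ w))
    (hw₂ : IsUnit (pencil a₂ b₂ w)) :
    res (Matrix.fromBlocks a₁ 0 0 a₂) (Matrix.fromBlocks b₁ 0 0 b₂) w = Matrix.fromBlocks (res a₁ b₁ w) 0 0 (res a₂ b₂ w) := by
  refine res_eq_of_pencil_mul_eq (by rw [pencil_fromBlocks]; exact isUnit_fromBlocks_diag hw₁ hw₂) ?_
  rw [pencil_fromBlocks, Matrix.fromBlocks_multiply]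
  simp [pencil_mul_res_self hw₁, pencil_mul_res_self hw₂]

/-- **`P₀` of a block sum is the block sum of the `P₀`.** [cite: HusemollerFibreBundles1994, Ch. 11 Prop. 4.6] -/
theorem IsRegular.P0_fromBlocks {a₁ b₁ : Matrix ι₁ ι₁ ℂ} {a₂ b₂ : Matrix ι₂ ι₂ ℂ} (h₁ : IsRegular a₁ b₁) (h₂ : IsRegular a₂ b₂) :
    P0 (Matrix.fromBlocks a₁ 0 0 a₂) (Matrix.fromBlocks b₁ 0 0 b₂) = Matrix.fromBlocks (P0 a₁ b₁) (0 : Matrix ι₁ ι₂ ℂ) 0 (P0 a₂ b₂) := by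
  have h := h₁.fromBlocks h₂
  have hres : ∀ w ∈ sphere (0 : ℂ) 1, res (Matrix.fromBlocks a₁ 0 0 a₂) (Matrix.fromBlocks b₁ 0 0 b₂) w =
      Matrix.fromBlocks (res a₁ b₁ w) 0 0 (res a₂ b₂ w) := fun w hw ↦
    res_fromBlocks (h₁ w (by simpa using hw)) (h₂ w (by simpa using hw))
  ext i j
  rw [h.P0_apply]
  rcases i with i | i <;> rcases j with j | j
  · rw [Matrix.fromBlocks_apply₁₁, h₁.P0_apply]
    congr 1
    exact circleIntegral.integral_congr zero_le_one fun w hw ↦ by rw [hres w hw]; rfl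
  · rw [Matrix.fromBlocks_apply₁₂, Matrix.zero_apply]
    rw [circleIntegral.integral_congr zero_le_one (g := fun _ ↦ (0 : ℂ)) fun w hw ↦ by rw [hres w hw]; rfl,
      circleIntegral_const_eq_zero, mul_zero]
  · rw [Matrix.fromBlocks_apply₂₁, Matrix.zero_apply]
    rw [circleIntegral.integral_congr zero_le_one (g := fun _ ↦ (0 : ℂ)) fun w hw ↦ by rw [hres w hw]; rfl,
      circleIntegral_const_eq_zero, mul_zero]
  · rw [Matrix.fromBlocks_apply₂₂, h₂.P0_apply]
    congr 1
    exact circleIntegral.integral_congr zero_le_one fun w hw ↦ by rw [hres w hw]; rfl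

end Blocks

/-! ### Special pencils -/

omit [DecidableEq ι] in
/-- `a = 0`: `P₀ = 0`. [cite: HusemollerFibreBundles1994, Ch. 11 Prop. 4.5] -/
theorem P0_zero_left [DecidableEq ι] (b : Matrix ι ι ℂ) : P0 (0 : Matrix ι ι ℂ) b = 0 := by
  have : res (0 : Matrix ι ι ℂ) b = fun _ ↦ 0 := by ext w i j; simp [res]
  rw [P0, this, circleIntegral_const_eq_zero, smul_zero]

/-- `b = 0`, `a` a unit: the pencil is regular. [folklore] -/
theorem isRegular_of_b_eq_zero {a : Matrix ι ι ℂ} (ha : IsUnit a) : IsRegular a 0 := by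
  intro w hw
  have hw0 : w ≠ 0 := by rintro rfl; simp at hw
  rw [pencil, add_zero]
  exact IsUnit.smul (Units.mk0 w hw0) ha

/-- `b = 0`, `a` a unit: `res w = w⁻¹ · 1` for `w ≠ 0`. [folklore] -/
theorem res_of_b_eq_zero {a : Matrix ι ι ℂ} (ha : IsUnit a) {w : ℂ} (hw : w ≠ 0) : res a 0 w = w⁻¹ • (1 : Matrix ι ι ℂ) := by
  refine res_eq_of_pencil_mul_eq (by rw [pencil, add_zero]; exact IsUnit.smul (Units.mk0 w hw) ha) ?_
  rw [pencil, add_zero, Matrix.smul_mul, Matrix.mul_smul, Matrix.mul_one, smul_smul, mul_inv_cancel₀ hw, one_smul]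

/-- **`b = 0`, `a` a unit: `P₀ = 1`** (all eigenvalues at `w = 0`). [cite: HusemollerFibreBundles1994, Ch. 11 Prop. 4.5] -/
theorem P0_of_b_eq_zero {a : Matrix ι ι ℂ} (ha : IsUnit a) : P0 a 0 = 1 := by
  rw [P0, circleIntegral.integral_congr zero_le_one (g := fun w ↦ w⁻¹ • (1 : Matrix ι ι ℂ)) fun w hw ↦
      res_of_b_eq_zero ha (by rintro rfl; simp at hw),
    circleIntegral.integral_smul_const, circleIntegral_inv_unit, smul_smul, inv_mul_cancel₀ (by simp [Real.pi_ne_zero, I_ne_zero]),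
    one_smul]

/-! ### The pencil of `z P + (1 - P)` after linearisation: `P₀ = P ⊕ 0` -/

section Special

/-- The constant coefficient `[[1-e, e],[0, 1]]`. [cite: HusemollerFibreBundles1994, Ch. 11 Notation 3.1] -/
def spA (e : Matrix ι ι ℂ) : Matrix (ι ⊕ ι) (ι ⊕ ι) ℂ := Matrix.fromBlocks (1 - e) e 0 1

variable (ι) in
/-- The `z`-coefficient `[[0, 0],[-1, 0]]`. [cite: HusemollerFibreBundles1994, Ch. 11 Notation 3.1] -/
def spB : Matrix (ι ⊕ ι) (ι ⊕ ι) ℂ := Matrix.fromBlocks 0 0 (-1) 0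

/-- The explicit inverse of `w B + A`. [folklore] -/
def spInv (e : Matrix ι ι ℂ) (w : ℂ) : Matrix (ι ⊕ ι) (ι ⊕ ι) ℂ :=
  Matrix.fromBlocks ((1 - e) + w⁻¹ • e) (-(w⁻¹ • e)) (w • (1 - e) + e) (1 - e)

omit [Fintype ι] in
/-- Auxiliary statement for spectral projections of special pencils. [folklore] -/
theorem pencil_sp (e : Matrix ι ι ℂ) (w : ℂ) : pencil (spB ι) (spA e) w = Matrix.fromBlocks (1 - e) e (-(w • (1 : Matrix ι ι ℂ))) 1 := by
  simp only [pencil, spB, spA, Matrix.fromBlocks_smul, Matrix.fromBlocks_add, smul_zero, zero_add, smul_neg, add_zero]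

section
variable {e : Matrix ι ι ℂ} (he : e * e = e)
include he

/-- Auxiliary statement for spectral projections of special pencils. [folklore] -/
theorem idem_aux₁ : (1 - e) * e = 0 := by rw [Matrix.sub_mul, Matrix.one_mul, he, sub_self]
/-- Auxiliary statement for spectral projections of special pencils. [folklore] -/
theorem idem_aux₂ : e * (1 - e) = 0 := by rw [Matrix.mul_sub, Matrix.mul_one, he, sub_self]
/-- Auxiliary statement for spectral projections of special pencils. [folklore] -/
theorem idem_aux₃ : (1 - e) * (1 - e) = 1 - e := by rw [Matrix.mul_sub, Matrix.mul_one, idem_aux₁ he, sub_zero]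

/-- Auxiliary statement for spectral projections of special pencils. [folklore] -/
theorem pencil_sp_mul_spInv {w : ℂ} (hw : w ≠ 0) : pencil (spB ι) (spA e) w * spInv e w = 1 := by
  have h1 := idem_aux₁ he
  have h2 := idem_aux₂ he
  have h3 := idem_aux₃ he
  rw [pencil_sp, spInv, Matrix.fromBlocks_multiply, ← Matrix.fromBlocks_one]
  congr 1
  · rw [Matrix.mul_add, Matrix.mul_smul, h3, h1, smul_zero, add_zero, Matrix.mul_add, Matrix.mul_smul, he, h2, smul_zero,
      zero_add, sub_add_cancel]
  · rw [Matrix.mul_neg, Matrix.mul_smul, h1, smul_zero, neg_zero, zero_add, h2]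
  · rw [Matrix.neg_mul, Matrix.smul_mul, Matrix.one_mul, Matrix.one_mul, smul_add, smul_smul, mul_inv_cancel₀ hw, one_smul]
    abel
  · rw [Matrix.neg_mul, Matrix.smul_mul, Matrix.one_mul, Matrix.one_mul, smul_neg, neg_neg, smul_smul, mul_inv_cancel₀ hw, one_smul,
      add_sub_cancel]

/-- Auxiliary statement for spectral projections of special pencils. [folklore] -/
theorem spInv_mul_pencil_sp {w : ℂ} (hw : w ≠ 0) : spInv e w * pencil (spB ι) (spA e) w = 1 := by
  have h1 := idem_aux₁ he
  have h2 := idem_aux₂ he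
  have h3 := idem_aux₃ he
  rw [pencil_sp, spInv, Matrix.fromBlocks_multiply, ← Matrix.fromBlocks_one]
  congr 1
  · rw [Matrix.add_mul, Matrix.smul_mul, h3, Matrix.neg_mul, Matrix.smul_mul, Matrix.mul_neg, Matrix.mul_smul, Matrix.mul_one, smul_neg,
      neg_neg, smul_smul, inv_mul_cancel₀ hw, one_smul, h2, smul_zero, add_zero, sub_add_cancel]
  · rw [Matrix.add_mul, Matrix.smul_mul, h1, he, Matrix.neg_mul, Matrix.smul_mul, Matrix.mul_one, zero_add, add_neg_cancel]
  · rw [Matrix.add_mul, Matrix.smul_mul, h3, h2, add_zero, Matrix.mul_neg, Matrix.mul_smul, Matrix.mul_one, add_neg_cancel]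
  · rw [Matrix.add_mul, Matrix.smul_mul, h1, he, smul_zero, zero_add, Matrix.mul_one, add_sub_cancel]

/-- Auxiliary statement for spectral projections of special pencils. [folklore] -/
theorem isUnit_pencil_sp {w : ℂ} (hw : w ≠ 0) : IsUnit (pencil (spB ι) (spA e) w) :=
  ⟨⟨_, _, pencil_sp_mul_spInv he hw, spInv_mul_pencil_sp he hw⟩, rfl⟩

/-- The special pencil is regular. [folklore] -/
theorem isRegular_sp : IsRegular (spB ι) (spA e) := fun w hw ↦ isUnit_pencil_sp he (by rintro rfl; simp at hw)

/-- `res` for the special pencil: `[[w⁻¹ e, 0],[-(1-e), 0]]`. [folklore] -/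
theorem res_sp {w : ℂ} (hw : w ≠ 0) : res (spB ι) (spA e) w = Matrix.fromBlocks (w⁻¹ • e) 0 (-(1 - e)) 0 := by
  refine res_eq_of_pencil_mul_eq (isUnit_pencil_sp he hw) ?_
  rw [pencil_sp, Matrix.fromBlocks_multiply, spB]
  congr 1
  · rw [Matrix.mul_smul, idem_aux₁ he, smul_zero, Matrix.mul_neg, idem_aux₂ he, neg_zero, add_zero]
  · rw [Matrix.mul_zero, Matrix.mul_zero, add_zero]
  · rw [Matrix.neg_mul, Matrix.smul_mul, Matrix.one_mul, Matrix.mul_neg, Matrix.one_mul, smul_smul, mul_inv_cancel₀ hw, one_smul]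
    abel
  · rw [Matrix.mul_zero, Matrix.mul_zero, add_zero]

/-- **`P₀` of the special pencil is `e ⊕ 0`**: the `+`-bundle of the linearisation of
`z P + (1 - P)` is `im P`. [cite: HusemollerFibreBundles1994, Ch. 11 Thm. 5.4] -/
theorem P0_sp : P0 (spB ι) (spA e) = Matrix.fromBlocks e 0 0 0 := by
  have hreg := isRegular_sp (ι := ι) he
  have hres : ∀ w ∈ sphere (0 : ℂ) 1, res (spB ι) (spA e) w = Matrix.fromBlocks (w⁻¹ • e) 0 (-(1 - e)) 0 := fun w hw ↦
    res_sp he (by rintro rfl; simp at hw)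
  have hc : (2 * π * I : ℂ)⁻¹ * (2 * π * I) = 1 := inv_mul_cancel₀ (by simp [Real.pi_ne_zero, I_ne_zero])
  ext i j
  rw [hreg.P0_apply]
  rcases i with i | i <;> rcases j with j | j
  · rw [Matrix.fromBlocks_apply₁₁, circleIntegral.integral_congr zero_le_one (g := fun w ↦ e i j * w⁻¹) fun w hw ↦ by
        rw [hres w hw]; simp [Matrix.smul_apply, mul_comm],
      circleIntegral.integral_const_mul, circleIntegral_inv_unit, mul_comm (e i j), ← mul_assoc, hc, one_mul]
  · rw [Matrix.fromBlocks_apply₁₂, Matrix.zero_apply, circleIntegral.integral_congr zero_le_one (g := fun _ ↦ (0 : ℂ)) fun w hw ↦ by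
        rw [hres w hw]; rfl, circleIntegral_const_eq_zero, mul_zero]
  · rw [Matrix.fromBlocks_apply₂₁, Matrix.zero_apply, circleIntegral.integral_congr zero_le_one (g := fun _ ↦ (-(1 - e) i j : ℂ))
        fun w hw ↦ by rw [hres w hw]; rfl, circleIntegral_const_eq_zero, mul_zero]
  · rw [Matrix.fromBlocks_apply₂₂, Matrix.zero_apply, circleIntegral.integral_congr zero_le_one (g := fun _ ↦ (0 : ℂ)) fun w hw ↦ by
        rw [hres w hw]; rfl, circleIntegral_const_eq_zero, mul_zero]

end

end Special


/-! ### Re-indexing -/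

section Reindex

variable {κ : Type} [Fintype κ] [DecidableEq κ] (eq : ι ≃ κ)

omit [Fintype ι] [DecidableEq ι] [Fintype κ] [DecidableEq κ] in
/-- Auxiliary statement for spectral projections of special pencils. [folklore] -/
theorem pencil_reindex (a b : Matrix ι ι ℂ) (w : ℂ) :
    pencil (Matrix.reindex eq eq a) (Matrix.reindex eq eq b) w = Matrix.reindex eq eq (pencil a b w) := by
  simp only [pencil, Matrix.reindex_apply, Matrix.submatrix_smul, Matrix.submatrix_add]; rfl

/-- Auxiliary statement for spectral projections of special pencils. [folklore] -/
theorem res_reindex {a b : Matrix ι ι ℂ} {w : ℂ} (hw : IsUnit (pencil a b w)) :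
    res (Matrix.reindex eq eq a) (Matrix.reindex eq eq b) w = Matrix.reindex eq eq (res a b w) := by
  have hw' : IsUnit (pencil (Matrix.reindex eq eq a) (Matrix.reindex eq eq b) w) := by
    rw [pencil_reindex]; exact hw.map (Matrix.reindexAlgEquiv ℂ ℂ eq)
  refine res_eq_of_pencil_mul_eq hw' ?_
  rw [pencil_reindex, Matrix.reindex_apply, Matrix.reindex_apply, Matrix.submatrix_mul_equiv, pencil_mul_res_self hw]; rfl

/-- Auxiliary statement for spectral projections of special pencils. [folklore] -/
theorem IsRegular.reindex {a b : Matrix ι ι ℂ} (h : IsRegular a b) : IsRegular (Matrix.reindex eq eq a) (Matrix.reindex eq eq b) :=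
  fun w hw ↦ by rw [pencil_reindex]; exact (h w hw).map (Matrix.reindexAlgEquiv ℂ ℂ eq)

/-- **`P₀` commutes with re-indexing.** [folklore] -/
theorem IsRegular.P0_reindex {a b : Matrix ι ι ℂ} (h : IsRegular a b) :
    P0 (Matrix.reindex eq eq a) (Matrix.reindex eq eq b) = Matrix.reindex eq eq (P0 a b) := by
  ext i j
  rw [(h.reindex eq).P0_apply]
  change _ = P0 a b (eq.symm i) (eq.symm j)
  rw [h.P0_apply]
  congr 1
  refine circleIntegral.integral_congr zero_le_one fun w hw ↦ ?_
  rw [res_reindex eq (h w (by simpa using hw))]; rfl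

end Reindex

end Literature.AlgebraicTopology.KTheory.Pencil

end
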